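import Summits.Ventures.PercRepro.NullityCircuitsB
import Summits.Ventures.PercRepro.RankLevelSetTheoremC

/-!
# PercRepro — C-025 at `q = 3`, corank `4`, with an EXPLICIT rank threshold (night-1, gen 1)

`proofs/NIGHT-1-C025-induction.md` §10 Remark (b), made explicit and kernel-checked: every simple finite matroid
(all circuits have `≥ 3` elements) of rank `p` with `|E| = p + 4 ≥ 100` satisfies the `C025` body
`Φ(p,3)·#U(p,3) ≤ #Y(p,3)`. The non-effective threshold `N₀` of `exists_N₀_c025_simple` (a limit argument) is
replaced by the number `100` through a sharper count of `#U` at corank `4`: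

* `circuitsEq M j`, `ncard_circuitsEq_le` — the circuits with exactly `j ≤ k` elements are `j`-subsets of the union
  of all circuits with `≤ k` elements, which has `≤ k·d` elements (Corollary N′): at most `C(k·d, j)` of them;
* `ncard_four_sets_eRk_le_three` — a `4`-set of rank `≤ 3` is a `4`-circuit or a `3`-circuit plus one point:
  at most `s₃·n + s₄` of them;
* `topCount_le_corank_four` — at corank `4` the rank-`3` side of a `U`-partition is coindependent, hence has `3` or
  `4` elements: `#U(p,3) ≤ C(n,3) + s₃·n + s₄ ≤ C(n,3) + 560·n + 1820`;
* `corank_four_arith` — the explicit inequality `2^{n−1}·(C(n,3) + 560n + 1820) + 2·C(n−1,3)·Σ_{j≤7} C(n,j) ≤ 2^n·C(n−1,3)`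
  for `n ≥ 100` (with `Φ(p,3) ≤ 2^{n−1}/C(n−1,3)`, `#{r ≤ 3} ≤ Σ_{j≤7} C(n,j)`, `#{spanning} ≤ Σ_{j≤4} C(n,j)`);
* **`c025_corank_four_simple`** — the theorem.
Axioms: standard.
-/

namespace PercRepro

namespace Matroid

open Set

variable {α : Type*} {M : _root_.Matroid α}

/-- The circuits of `M` with exactly `j` elements. -/
def circuitsEq (M : _root_.Matroid α) (j : ℕ) : Set (Set α) :=
  {C : Set α | M.IsCircuit C ∧ C.ncard = j}

/-- A circuit with exactly `j ≤ k` elements is a circuit with at most `k` elements. -/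
theorem circuitsEq_subset_circuitsLE [M.Finite] {j k : ℕ} (hjk : j ≤ k) :
    circuitsEq M j ⊆ circuitsLE M k := by
  intro C hC
  refine ⟨hC.1, ?_⟩
  have hfin : C.Finite := M.ground_finite.subset hC.1.subset_ground
  rw [← hfin.cast_ncard_eq, hC.2]
  exact_mod_cast hjk

/-- `circuitsEq M j` is finite for a finite matroid. -/
theorem circuitsEq_finite [M.Finite] (j : ℕ) : (circuitsEq M j).Finite :=
  (circuitsLE_finite (M := M) j).subset (circuitsEq_subset_circuitsLE le_rfl)

/-- **At most `C(k·d, j)` circuits with exactly `j ≤ k` elements** in a finite matroid with `|E| = r(E) + d`: they are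
`j`-subsets of the union of all circuits with `≤ k` elements, which has at most `k·d` elements (Corollary N′). -/
theorem ncard_circuitsEq_le [M.Finite] {j k d : ℕ} (hjk : j ≤ k) (hd : M.E.encard = M.eRank + d) :
    (circuitsEq M j).ncard ≤ (k * d).choose j := by
  classical
  set S := ⋃₀ circuitsLE M k with hSdef
  have hSE : S ⊆ M.E := by
    intro x hx
    obtain ⟨C, hC, hxC⟩ := Set.mem_sUnion.1 hx
    exact subset_ground_of_mem_circuitsLE hC hxC
  have hSfin : S.Finite := M.ground_finite.subset hSE
  have hSsize : S.ncard ≤ k * d := by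
    have := encard_sUnion_circuitsLE_le (M := M) (k := k) hd
    rw [← hSfin.cast_ncard_eq] at this
    exact_mod_cast this
  have hsub : circuitsEq M j ⊆ {X : Set α | X ⊆ (hSfin.toFinset : Set α) ∧ X.ncard = j} := by
    intro C hC
    have hCS : C ⊆ S := Set.subset_sUnion_of_mem (circuitsEq_subset_circuitsLE hjk hC)
    exact ⟨by rw [Set.Finite.coe_toFinset]; exact hCS, hC.2⟩
  calc (circuitsEq M j).ncard
      ≤ {X : Set α | X ⊆ (hSfin.toFinset : Set α) ∧ X.ncard = j}.ncard :=
        Set.ncard_le_ncard hsub ((hSfin.toFinset.finite_toSet.finite_subsets).subset (fun X hX => hX.1))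
    _ = hSfin.toFinset.card.choose j := ncard_subsets_ncard_eq _ _
    _ ≤ (k * d).choose j := by
        apply Nat.choose_le_choose
        rw [← Set.ncard_eq_toFinset_card S hSfin]
        exact hSsize

/-- **The `4`-subsets of `E` of rank `≤ 3`** in a matroid all of whose circuits have `≥ 3` elements: each one is a
circuit with `4` elements, or a circuit with `3` elements together with one further point; so they number at most
`s₃ · |E| + s₄`. -/
theorem ncard_four_sets_eRk_le_three [M.Finite] (hcirc : ∀ C, M.IsCircuit C → 3 ≤ C.encard) :
    {B : Set α | B ⊆ M.E ∧ B.ncard = 4 ∧ M.eRk B ≤ 3}.ncard ≤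
      (circuitsEq M 3).ncard * M.ground_finite.toFinset.card + (circuitsEq M 4).ncard := by
  classical
  have hE : (M.ground_finite.toFinset : Set α) = M.E := Set.Finite.coe_toFinset _
  -- the singletons of `E`
  set Pts : Set (Set α) := {X : Set α | X ⊆ (M.ground_finite.toFinset : Set α) ∧ X.ncard = 1} with hPts
  have hPts_card : Pts.ncard = M.ground_finite.toFinset.card := by
    rw [hPts, ncard_subsets_ncard_eq, Nat.choose_one_right]
  have hPts_fin : Pts.Finite :=
    (M.ground_finite.toFinset.finite_toSet.finite_subsets).subset (fun X hX => hX.1)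
  -- every such `B` is `C ∪ X` with `C` a `3`-circuit and `X` a singleton, or a `4`-circuit
  have hcover : {B : Set α | B ⊆ M.E ∧ B.ncard = 4 ∧ M.eRk B ≤ 3} ⊆
      (fun P : Set α × Set α => P.1 ∪ P.2) '' (circuitsEq M 3 ×ˢ Pts) ∪ circuitsEq M 4 := by
    rintro B ⟨hBE, hB4, hBr⟩
    have hBfin : B.Finite := M.ground_finite.subset hBE
    -- `B` is dependent: an independent `4`-set has rank `4`
    have hdep : M.Dep B := by
      rw [_root_.Matroid.dep_iff]
      refine ⟨fun hind => ?_, hBE⟩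
      have h := hind.eRk_eq_encard
      rw [← hBfin.cast_ncard_eq, hB4] at h
      rw [h] at hBr
      have h' : (4 : ℕ) ≤ 3 := by exact_mod_cast hBr
      omega
    obtain ⟨C, hCB, hC⟩ := hdep.exists_isCircuit_subset
    have hCfin : C.Finite := hBfin.subset hCB
    have hC3 : 3 ≤ C.ncard := by
      have := hcirc C hC
      rw [← hCfin.cast_ncard_eq] at this
      exact_mod_cast this
    have hC4 : C.ncard ≤ 4 := by
      rw [← hB4]; exact Set.ncard_le_ncard hCB hBfin
    rcases Nat.lt_or_ge C.ncard 4 with h3 | h4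
    · -- `|C| = 3` and `B = C ∪ (B ∖ C)` with `|B ∖ C| = 1`
      have hC3' : C.ncard = 3 := by omega
      refine Or.inl ⟨(C, B \ C), ⟨⟨hC, hC3'⟩, ⟨?_, ?_⟩⟩, ?_⟩
      · rw [hE]; exact Set.sdiff_subset.trans hBE
      · rw [Set.ncard_sdiff hCB hCfin, hB4, hC3']
      · exact Set.union_sdiff_cancel hCB
    · -- `|C| = 4 = |B|`, so `C = B`
      have hCB' : C = B := Set.eq_of_subset_of_ncard_le hCB (by omega) hBfin
      exact Or.inr ⟨hCB' ▸ hC, hB4⟩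
  have hfin1 : (circuitsEq M 3 ×ˢ Pts).Finite := (circuitsEq_finite (M := M) 3).prod hPts_fin
  have hfin2 : (circuitsEq M 4).Finite := circuitsEq_finite (M := M) 4
  calc {B : Set α | B ⊆ M.E ∧ B.ncard = 4 ∧ M.eRk B ≤ 3}.ncard
      ≤ ((fun P : Set α × Set α => P.1 ∪ P.2) '' (circuitsEq M 3 ×ˢ Pts) ∪ circuitsEq M 4).ncard :=
        Set.ncard_le_ncard hcover ((hfin1.image _).union hfin2)
    _ ≤ ((fun P : Set α × Set α => P.1 ∪ P.2) '' (circuitsEq M 3 ×ˢ Pts)).ncard + (circuitsEq M 4).ncard :=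
        Set.ncard_union_le _ _
    _ ≤ (circuitsEq M 3 ×ˢ Pts).ncard + (circuitsEq M 4).ncard := by
        gcongr
        exact Set.ncard_image_le hfin1
    _ = (circuitsEq M 3).ncard * M.ground_finite.toFinset.card + (circuitsEq M 4).ncard := by
        rw [Set.ncard_prod, hPts_card]

/-- **`#U(p,3)` at corank `4`**: in a matroid of rank `p` with `|E| = p + 4` all of whose circuits have `≥ 3`
elements, the rank-`3` side `B = E ∖ A` of a `U`-partition is coindependent (`A` spans, so `|A| ≥ p`), hence has `3`
or `4` elements; so `#U(p,3) ≤ C(n,3) + s₃·n + s₄`. -/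
theorem topCount_le_corank_four [M.Finite] (hcirc : ∀ C, M.IsCircuit C → 3 ≤ C.encard) {p : ℕ}
    (hd : M.E.encard = M.eRank + 4) (hR : M.eRank = (p : ℕ∞)) :
    topCount M p 3 ≤ M.ground_finite.toFinset.card.choose 3 +
      (circuitsEq M 3).ncard * M.ground_finite.toFinset.card + (circuitsEq M 4).ncard := by
  classical
  have hE : (M.ground_finite.toFinset : Set α) = M.E := Set.Finite.coe_toFinset _
  have hinj : Set.InjOn (fun A : Set α => M.E \ A)
      {A : Set α | A ⊆ M.E ∧ M.eRk A = (p : ℕ∞) ∧ M.eRk (M.E \ A) = ((3 : ℕ) : ℕ∞)} := by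
    intro X hX Y hY hXY
    simp only at hXY
    rw [← Set.sdiff_sdiff_cancel_left hX.1, hXY, Set.sdiff_sdiff_cancel_left hY.1]
  have hmaps : ∀ A ∈ {A : Set α | A ⊆ M.E ∧ M.eRk A = (p : ℕ∞) ∧ M.eRk (M.E \ A) = ((3 : ℕ) : ℕ∞)},
      (fun A : Set α => M.E \ A) A ∈
        {B : Set α | B ⊆ (M.ground_finite.toFinset : Set α) ∧ B.ncard = 3} ∪
        {B : Set α | B ⊆ M.E ∧ B.ncard = 4 ∧ M.eRk B ≤ 3} := by
    rintro A ⟨hAE, hAr, hBr⟩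
    simp only
    have hBE : M.E \ A ⊆ M.E := Set.sdiff_subset
    have hBfin : (M.E \ A).Finite := M.ground_finite.subset hBE
    -- `|B| ≥ r(B) = 3`
    have h3 : ((3 : ℕ) : ℕ∞) ≤ (M.E \ A).encard := by rw [← hBr]; exact M.eRk_le_encard _
    -- `|A| ≥ r(A) = p` and `|A| + |B| = |E| = p + 4`, so `|B| ≤ 4`
    have hAp : (p : ℕ∞) ≤ A.encard := by rw [← hAr]; exact M.eRk_le_encard A
    have hsum : A.encard + (M.E \ A).encard = M.E.encard := by
      rw [add_comm]; exact Set.encard_sdiff_add_encard_of_subset hAE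
    have h4 : (M.E \ A).encard ≤ 4 := by
      have h : (p : ℕ∞) + (M.E \ A).encard ≤ (p : ℕ∞) + 4 := by
        calc (p : ℕ∞) + (M.E \ A).encard ≤ A.encard + (M.E \ A).encard := by gcongr
          _ = M.E.encard := hsum
          _ = (p : ℕ∞) + 4 := by rw [hd, hR]
      exact (WithTop.add_le_add_iff_left (WithTop.natCast_ne_top p)).1 h
    rw [← hBfin.cast_ncard_eq] at h3 h4
    have h3' : 3 ≤ (M.E \ A).ncard := by exact_mod_cast h3
    have h4' : (M.E \ A).ncard ≤ 4 := by exact_mod_cast h4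
    rcases Nat.lt_or_ge (M.E \ A).ncard 4 with hlt | hge
    · exact Or.inl ⟨by rw [hE]; exact hBE, by omega⟩
    · refine Or.inr ⟨hBE, by omega, ?_⟩
      rw [hBr]; exact_mod_cast le_refl (3 : ℕ)
  have hfin : ({B : Set α | B ⊆ (M.ground_finite.toFinset : Set α) ∧ B.ncard = 3} ∪
        {B : Set α | B ⊆ M.E ∧ B.ncard = 4 ∧ M.eRk B ≤ 3}).Finite :=
    ((M.ground_finite.toFinset.finite_toSet.finite_subsets).subset (fun X hX => hX.1)).union
      (M.ground_finite.finite_subsets.subset (fun X hX => hX.1))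
  calc topCount M p 3
      = {A : Set α | A ⊆ M.E ∧ M.eRk A = (p : ℕ∞) ∧ M.eRk (M.E \ A) = ((3 : ℕ) : ℕ∞)}.ncard := rfl
    _ ≤ ({B : Set α | B ⊆ (M.ground_finite.toFinset : Set α) ∧ B.ncard = 3} ∪
          {B : Set α | B ⊆ M.E ∧ B.ncard = 4 ∧ M.eRk B ≤ 3}).ncard :=
        Set.ncard_le_ncard_of_injOn _ hmaps hinj hfin
    _ ≤ {B : Set α | B ⊆ (M.ground_finite.toFinset : Set α) ∧ B.ncard = 3}.ncard +
          {B : Set α | B ⊆ M.E ∧ B.ncard = 4 ∧ M.eRk B ≤ 3}.ncard := Set.ncard_union_le _ _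
    _ ≤ M.ground_finite.toFinset.card.choose 3 +
          ((circuitsEq M 3).ncard * M.ground_finite.toFinset.card + (circuitsEq M 4).ncard) := by
        rw [ncard_subsets_ncard_eq]
        gcongr
        exact ncard_four_sets_eRk_le_three hcirc
    _ = _ := by ring

end Matroid

/-! ### The explicit arithmetic -/

/-- `2^k ≥ 7k + 13` for `k ≥ 13`. -/
theorem two_pow_ge_seven_mul_add (k : ℕ) (hk : 13 ≤ k) : 7 * k + 13 ≤ 2 ^ k := by
  induction k with
  | zero => omega
  | succ k ih =>
    rcases Nat.lt_or_ge k 13 with h | h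
    · have hk' : k = 12 := by omega
      subst hk'
      norm_num
    · have := ih h
      rw [pow_succ]
      omega

/-- `n^7 ≤ 2^(n−7)` for `n ≥ 100`. -/
theorem pow_seven_le_two_pow (n : ℕ) (hn : 100 ≤ n) : n ^ 7 ≤ 2 ^ (n - 7) := by
  set k := (n - 7) / 7 with hk
  have hk13 : 13 ≤ k := by omega
  have hnk : n ≤ 2 ^ k := by
    have h1 := two_pow_ge_seven_mul_add k hk13
    have h2 : n ≤ 7 * k + 13 := by omega
    omega
  calc n ^ 7 ≤ (2 ^ k) ^ 7 := Nat.pow_le_pow_left hnk 7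
    _ = 2 ^ (7 * k) := by rw [← pow_mul, mul_comm]
    _ ≤ 2 ^ (n - 7) := Nat.pow_le_pow_right (by norm_num) (by omega)

/-- `6·C(m+3, 3) = (m+1)(m+2)(m+3)`. -/
theorem six_mul_choose_three (m : ℕ) : 6 * (m + 3).choose 3 = (m + 1) * (m + 2) * (m + 3) := by
  have h := Nat.descFactorial_eq_factorial_mul_choose (m + 3) 3
  have h' : (m + 3).descFactorial 3 = (m + 1) * (m + 2) * (m + 3) := by
    simp only [Nat.descFactorial_succ, Nat.descFactorial_zero]
    have e1 : m + 3 - 2 = m + 1 := by omega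
    have e2 : m + 3 - 1 = m + 2 := by omega
    rw [e1, e2, Nat.sub_zero, mul_one]
    ring
  have h6 : (3 : ℕ).factorial = 6 := rfl
  rw [h', h6] at h
  exact h.symm

/-- **The explicit inequality** behind the corank-`4` theorem: for `n ≥ 100`,
`2^{n−1}·(C(n,3) + 560·n + 1820) + 2·C(n−1,3)·Σ_{j≤7} C(n,j) ≤ 2^n·C(n−1,3)`. -/
theorem corank_four_arith (n : ℕ) (hn : 100 ≤ n) :
    2 ^ (n - 1) * (n.choose 3 + 560 * n + 1820) +
      2 * ((n - 1).choose 3) * (∑ j ∈ Finset.range 8, n.choose j) ≤ 2 ^ n * (n - 1).choose 3 := by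
  obtain ⟨m, rfl⟩ : ∃ m, n = m + 3 := ⟨n - 3, by omega⟩
  have hm : 97 ≤ m := by omega
  have e1 : m + 3 - 1 = m + 2 := by omega
  rw [e1]
  -- the binomials
  have hX : 6 * (m + 3).choose 3 = (m + 1) * (m + 2) * (m + 3) := six_mul_choose_three m
  have hZ : 6 * (m + 2).choose 3 = m * (m + 1) * (m + 2) := by
    have h := six_mul_choose_three (m - 1)
    have e : m - 1 + 3 = m + 2 := by omega
    have e' : m - 1 + 1 = m := by omega
    have e'' : m - 1 + 2 = m + 1 := by omega
    rw [e, e', e''] at h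
    exact h
  -- the binomial sum
  have hS : (∑ j ∈ Finset.range 8, (m + 3).choose j) ≤ 8 * (m + 3) ^ 7 := by
    have : ∀ j ∈ Finset.range 8, (m + 3).choose j ≤ (m + 3) ^ 7 := by
      intro j hj
      rw [Finset.mem_range] at hj
      calc (m + 3).choose j ≤ (m + 3) ^ j := Nat.choose_le_pow _ _
        _ ≤ (m + 3) ^ 7 := Nat.pow_le_pow_right (by omega) (by omega)
    calc (∑ j ∈ Finset.range 8, (m + 3).choose j) ≤ ∑ j ∈ Finset.range 8, (m + 3) ^ 7 :=
          Finset.sum_le_sum this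
      _ = 8 * (m + 3) ^ 7 := by rw [Finset.sum_const, Finset.card_range]; ring
  -- the exponential
  have hW : 16 * (m + 3) ^ 7 ≤ 2 ^ m := by
    have h := pow_seven_le_two_pow (m + 3) (by omega)
    have e : m + 3 - 7 = m - 4 := by omega
    rw [e] at h
    have e2 : 2 ^ m = 16 * 2 ^ (m - 4) := by
      rw [show (16 : ℕ) = 2 ^ 4 by norm_num, ← pow_add]
      congr 1
      omega
    rw [e2]
    exact Nat.mul_le_mul_left 16 h
  -- the polynomial inequality `12·P + 13440·m + 84000 ≤ 3·m·P`, `P = (m+1)(m+2)`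
  have hpoly : 12 * ((m + 1) * (m + 2)) + 13440 * m + 84000 ≤ 3 * m * ((m + 1) * (m + 2)) := by
    have ha : 97 * m ≤ m * m := Nat.mul_le_mul_right m hm
    have hb : 97 * (m * m) ≤ m * (m * m) := Nat.mul_le_mul_right (m * m) hm
    nlinarith [ha, hb]
  -- names for the atoms
  set X := (m + 3).choose 3 with hXdef
  set Z := (m + 2).choose 3 with hZdef
  set S := ∑ j ∈ Finset.range 8, (m + 3).choose j with hSdef
  set W := 2 ^ m with hWdef
  set Q := (m + 3) ^ 7 with hQdef
  have hpow2 : 2 ^ (m + 2) = 4 * W := by rw [hWdef, pow_add]; ring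
  have hpow3 : 2 ^ (m + 3) = 8 * W := by rw [hWdef, pow_add]; ring
  rw [hpow2, hpow3]
  -- multiply the goal by `6`
  apply Nat.le_of_mul_le_mul_left (c := 6) _ (by norm_num)
  have hL : 6 * (4 * W * (X + 560 * (m + 3) + 1820) + 2 * Z * S) =
      4 * W * ((6 * X) + 3360 * (m + 3) + 10920) + 2 * (6 * Z) * S := by ring
  have hR : 6 * (8 * W * Z) = 8 * W * (6 * Z) := by ring
  rw [hL, hR, hX, hZ]
  -- `2·B·S ≤ 16·B·Q ≤ B·W` with `B = m(m+1)(m+2)`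
  have hBS : 2 * (m * (m + 1) * (m + 2)) * S ≤ (m * (m + 1) * (m + 2)) * W := by
    calc 2 * (m * (m + 1) * (m + 2)) * S ≤ 2 * (m * (m + 1) * (m + 2)) * (8 * Q) := by
          gcongr
      _ = (m * (m + 1) * (m + 2)) * (16 * Q) := by ring
      _ ≤ (m * (m + 1) * (m + 2)) * W := Nat.mul_le_mul_left _ hW
  -- the remaining polynomial inequality, times `W`
  have hmain : 4 * W * ((m + 1) * (m + 2) * (m + 3) + 3360 * (m + 3) + 10920) +
      (m * (m + 1) * (m + 2)) * W ≤ 8 * W * (m * (m + 1) * (m + 2)) := by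
    have hcoef : 4 * ((m + 1) * (m + 2) * (m + 3) + 3360 * (m + 3) + 10920) + m * (m + 1) * (m + 2) ≤
        8 * (m * (m + 1) * (m + 2)) := by nlinarith [hpoly]
    calc 4 * W * ((m + 1) * (m + 2) * (m + 3) + 3360 * (m + 3) + 10920) + (m * (m + 1) * (m + 2)) * W
        = W * (4 * ((m + 1) * (m + 2) * (m + 3) + 3360 * (m + 3) + 10920) + m * (m + 1) * (m + 2)) := by ring
      _ ≤ W * (8 * (m * (m + 1) * (m + 2))) := Nat.mul_le_mul_left W hcoef
      _ = 8 * W * (m * (m + 1) * (m + 2)) := by ring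
  omega

/-- **C-025 at `q = 3`, corank `4`, EXPLICIT threshold** (night-1, gen 1): every simple finite matroid (all circuits
have `≥ 3` elements) of rank `p` with `|E| = p + 4` and `|E| ≥ 100` satisfies `Φ(p,3)·#U(p,3) ≤ #Y(p,3)`. -/
theorem c025_corank_four_simple {α : Type*} (M : _root_.Matroid α) [M.Finite] (p : ℕ)
    (hn : 100 ≤ M.E.ncard) (hd : M.E.encard = M.eRank + 4) (hR : M.eRank = (p : ℕ∞))
    (hcirc : ∀ C, M.IsCircuit C → 3 ≤ C.encard) :
    phiK p 3 * (Matroid.topCount M p 3 : ℚ) ≤ (Matroid.midCount M p 3 : ℚ) := by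
  classical
  set n := M.E.ncard with hn_def
  have hEcard : M.ground_finite.toFinset.card = n := by
    rw [hn_def, Set.ncard_eq_toFinset_card _ M.ground_finite]
  have hnpd : n = p + 4 := by
    have h := hd
    rw [← M.ground_finite.cast_ncard_eq, hR] at h
    exact_mod_cast h
  -- (U): #U ≤ C(n,3) + 560 n + 1820
  have hs3 : (Matroid.circuitsEq M 3).ncard ≤ 560 := by
    have h := Matroid.ncard_circuitsEq_le (M := M) (j := 3) (k := 4) (d := 4) (by norm_num) hd
    have e : (4 * 4).choose 3 = 560 := by decide
    rw [e] at h
    exact h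
  have hs4 : (Matroid.circuitsEq M 4).ncard ≤ 1820 := by
    have h := Matroid.ncard_circuitsEq_le (M := M) (j := 4) (k := 4) (d := 4) le_rfl hd
    have e : (4 * 4).choose 4 = 1820 := by decide
    rw [e] at h
    exact h
  have hU : Matroid.topCount M p 3 ≤ n.choose 3 + 560 * n + 1820 := by
    have h := Matroid.topCount_le_corank_four (M := M) hcirc hd hR
    rw [hEcard] at h
    have h' : (Matroid.circuitsEq M 3).ncard * n ≤ 560 * n := Nat.mul_le_mul_right n hs3
    omega
  -- (Y): 2^n ≤ #Y + Σ_{j ≤ 7} C(n,j) + Σ_{j ≤ 4} C(n,j)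
  have hY : 2 ^ n ≤ Matroid.midCount M p 3 + (∑ j ∈ Finset.range 8, n.choose j) +
      (∑ j ∈ Finset.range 5, n.choose j) := by
    have h := Matroid.two_pow_le_midCount_add (M := M) p 3 hR
    have hA := Matroid.ncard_eRk_le_le (M := M) (q := 3) (d := 4) hd
    have hB := Matroid.ncard_spanning_le (M := M) (d := 4) hd
    rw [hEcard] at h hA hB
    rw [show (3 + 4 + 1 : ℕ) = 8 from rfl] at hA
    rw [show (4 + 1 : ℕ) = 5 from rfl] at hB
    omega
  have hB' : (∑ j ∈ Finset.range 5, n.choose j) ≤ ∑ j ∈ Finset.range 8, n.choose j :=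
    Finset.sum_le_sum_of_subset_of_nonneg (Finset.range_mono (by norm_num : 5 ≤ 8))
      (fun _ _ _ => Nat.zero_le _)
  -- (Φ): Φ(p,3) ≤ 2^{n−1} / C(n−1,3)
  have hΦ := phiK_le_two_pow_div p 3
  have hp3 : p + 3 = n - 1 := by omega
  have hchoose : (n - 1).choose p = (n - 1).choose 3 := by
    have hp : p = n - 1 - 3 := by omega
    conv_lhs => rw [hp]
    exact Nat.choose_symm (by omega)
  rw [hp3, hchoose] at hΦ
  -- the arithmetic
  have harith := corank_four_arith n hn
  have hc : (0 : ℚ) < ((n - 1).choose 3 : ℚ) := by exact_mod_cast Nat.choose_pos (by omega)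
  -- to the rationals
  have h1 : ((2 ^ (n - 1) * (n.choose 3 + 560 * n + 1820) +
      2 * ((n - 1).choose 3) * (∑ j ∈ Finset.range 8, n.choose j) : ℕ) : ℚ) ≤
      ((2 ^ n * (n - 1).choose 3 : ℕ) : ℚ) := by exact_mod_cast harith
  have h2 : ((2 ^ n : ℕ) : ℚ) ≤ ((Matroid.midCount M p 3 + (∑ j ∈ Finset.range 8, n.choose j) +
      (∑ j ∈ Finset.range 5, n.choose j) : ℕ) : ℚ) := by exact_mod_cast hY
  have h3 : (((∑ j ∈ Finset.range 5, n.choose j : ℕ)) : ℚ) ≤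
      (((∑ j ∈ Finset.range 8, n.choose j : ℕ)) : ℚ) := by exact_mod_cast hB'
  have hUq : (Matroid.topCount M p 3 : ℚ) ≤ ((n.choose 3 + 560 * n + 1820 : ℕ) : ℚ) := by
    exact_mod_cast hU
  push_cast at h1 h2 h3 hUq
  have key : (2 : ℚ) ^ (n - 1) * ((n.choose 3 : ℚ) + 560 * n + 1820) ≤
      ((n - 1).choose 3 : ℚ) * (Matroid.midCount M p 3 : ℚ) := by
    nlinarith [h1, h2, h3, hc]
  calc phiK p 3 * (Matroid.topCount M p 3 : ℚ)
      ≤ ((2 : ℚ) ^ (n - 1) / ((n - 1).choose 3 : ℚ)) * (Matroid.topCount M p 3 : ℚ) :=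
        mul_le_mul_of_nonneg_right hΦ (by positivity)
    _ ≤ ((2 : ℚ) ^ (n - 1) / ((n - 1).choose 3 : ℚ)) * ((n.choose 3 : ℚ) + 560 * n + 1820) :=
        mul_le_mul_of_nonneg_left hUq (by positivity)
    _ ≤ (Matroid.midCount M p 3 : ℚ) := by
        rw [div_mul_eq_mul_div, div_le_iff₀ hc]
        linarith [key]

end PercRepro
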